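import Summits.Ventures.CertifiedManyBodySolver.Observables.KineticCeilingStiffnessTL
import Literature.MathematicalPhysics.QuantumLattice.HubbardTTPrimeCapCutDualRows
import Literature.MathematicalPhysics.QuantumLattice.InfVolFermionStateTTPrimeMeanEnergyBox
import HarnessLib

/-!
# Ventures/CertifiedManyBodySolver — Observables/StiffnessTLKineticCeilingURay.lean

HONEST FRAMING: one-sided certified CEILINGS on the flux stiffness (f-sum / kinetic class) and one-sided statements about the kinetic
energy of torus-limit ground states; no stiffness floor exists in this constraint class; not a superconductivity verdict; zero compute.

Cell `hubbard-obs` (D-0042), seat p2 (stiffness), `prover-hubbard-obs-p2-g8-0`. **The f-sum stiffness ceiling and the kinetic-class floor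
hold on HALF-LINES of the coupling, not only at the anchor** (the box / R1b form of the stiffness line): square lattice, `t = 1`, `t′ = 0`,
density `n` fixed.

* `meanEnergy_hubbardTTPrime_oneBody_eq_kineticDensity` — DICTIONARY: for a translation-invariant state the one-body mean energy
  `e_{Φ(1,0,0)}(ω)` IS the bond-form kinetic density `k(ω) = Σ_i (−1)Σ_σ(Re ω(c†_0c_{e_i}) + Re ω(c†_{e_i}c_0))` of
  `Observables/KineticCeilingStiffnessTL.lean` (`IsTranslationInvariant.meanEnergy_hubbardTTPrime_eq` + `hubbardEnergyDensity_eq_docc_add_hopping`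
  at `U = 0`, the diagonal terms carry `t′ = 0`).
* `forall_torusLimit_negKinetic_le_of_le_coupling` — **a kinetic CEILING transports UP the `U`-ray**: if `−k(ω) ≤ X` for every torus limit of
  unit `(rectN n L, S^z = 0)`-sector ground states at coupling `U₀ ≥ 0`, then the same holds at every `U ≥ U₀`. PROOF: Griffiths / Koma–Tasaki
  monotonicity of the conjugate observable for energy minimisers in the thermodynamic limit — hubbard-fast's rule «T-mono»,
  `IsTorusLimitOf.docc_le_and_oneBody_le_of_groundStates` (Literature/HubbardTTPrimeCapCutDualRows.lean: the one-body energy is non-decreasing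
  in `U` across the torus-limit ground-state classes) — applied against an inhabitant of the class at `U₀`
  (`exists_isTorusLimitOf_sectorGroundState_TT'`).
* `forall_torusLimit_le_negKinetic_of_coupling_le` — **a kinetic FLOOR transports DOWN the ray** (`0 ≤ U ≤ U₀`).
* `fluxStiffness_le_quarter_on_ray` — hence (T6, `fluxStiffness_le_quarter_of_forall_torusLimit_negKinetic_le`) a certified kinetic ceiling `X`
  at `(U₀, n)` makes `X/4` an f-sum stiffness ceiling for the zero-flux `(N_L, 0)` sectors at EVERY `U ≥ U₀`: for all `ρ_s, θ₀ > 0`, `L₀`, if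
  `ρ_s θ² ≤ E_L(U; θ) − E_L(U; 0)` on `|θ| ≤ θ₀` for all even `L ≥ L₀` then `ρ_s ≤ X/4`.
* `negKinetic_classFloor_on_ray` — and a certified class floor `K ≤ −k` at `U₀` bounds from below every kinetic ceiling `X` certified at any
  `U ∈ [0, U₀]` (`K ≤ X`): the «floor of the f-sum class» sentence on the whole segment.
* M3′ wrappers at `(8, 7/8, 0)`: `m3_tp0_fluxStiffness_le_quarter_on_ray_of_forall_negKinetic_le` (∀ `U ≥ 8`),
  `m3_tp0_negKinetic_classFloor_below_of_forall_le_negKinetic` (∀ `U ∈ [0, 8]`); the numeric instances (chord rows #354 ∧ #426, the `kinlo` node,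
  the class floor #354 ∧ #261) are in `Certificates/HubbardSquare_n7o8_stiffness_tp0_Uray.lean`.
What it does NOT say: nothing moves along `n` or `t′` here (the kinetic density is not monotone in those by this argument); the odd-moment (K3)
ceiling does not transport (its correction is not a conjugate observable); no statement at `T > 0`.
References: [Griffiths1966] §II and [KomaTasaki1994] §1 (monotonicity of conjugate observables of energy minimisers);
[ScalapinoWhiteZhang1993] §II and [HazraVermaRanderia2019] eq. (2) (f-sum ceiling); [BratteliRobinsonII1997] §6.2.4.
-/

noncomputable section

namespace Summit.Ventures.CertifiedManyBodySolver.Observables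

open Literature.MathematicalPhysics.QuantumLattice
open Literature.MathematicalPhysics.QuantumLattice.ThermodynamicLimit
open Literature.Probability.LatticeModels
open Matrix Finset Filter Topology
open scoped Matrix BigOperators ComplexOrder

/-! ## §1 Dictionary: the one-body mean energy at `(t, t′, U) = (1, 0, 0)` is the bond-form kinetic density -/

/-- For a translation-invariant state `ω` on `ℤ²`, `e_{Φ(1,0,0)}(ω) = Σ_i (−1)Σ_σ(Re ω(c†_0c_{e_i}) + Re ω(c†_{e_i}c_0))` — the one-body
(`U = 0`, `t′ = 0`) mean energy is the bond-form kinetic energy density. [cite: BratteliRobinsonII1997, §6.2.4] -/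
theorem meanEnergy_hubbardTTPrime_oneBody_eq_kineticDensity {ω : InfVolFermionState 2} (hω : ω.IsTranslationInvariant) :
    ω.meanEnergy (hubbardTTPrimeFermionInteraction 1 0 0) 1 =
      ∑ i : Fin 2, -(1 : ℝ) * ∑ σ : Fin 2,
        ((ω.expect {0, 0 + unitVec i}
            ((cAt 0 (mem_insert_self _ _) σ)ᴴ * cAt (0 + unitVec i) (mem_insert_of_mem (mem_singleton_self _)) σ)).re +
          (ω.expect {0, 0 + unitVec i}
            ((cAt (0 + unitVec i) (mem_insert_of_mem (mem_singleton_self _)) σ)ᴴ * cAt 0 (mem_insert_self _ _) σ)).re) := by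
  rw [hω.meanEnergy_hubbardTTPrime_eq 0 1 0, hω.hubbardEnergyDensity_eq_docc_add_hopping 1 0]
  have h0 : ∀ s : Fin 2, (ω.expect {0, 0 + diagVec s} ((diagHoppingFermionInteraction 0).Φ {0, 0 + diagVec s})).re = 0 := by
    intro s
    simp [diagHoppingFermionInteraction]
  simp [h0]

/-! ## §2 Transport along the `U`-ray (Griffiths / Koma–Tasaki monotonicity in the thermodynamic limit) -/

/-- **A certified kinetic CEILING transports UP the `U`-ray.** `0 ≤ U₀ ≤ U`, `0 ≤ n < 2`: if `−k(ω) ≤ X` for every torus limit `ω` of unit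
`(rectN n L, S^z = 0)`-sector ground states of `hubbardTorusTT' L 1 0 U₀`, then `−k(ω′) ≤ X` for every such torus limit `ω′` at coupling `U`
(the kinetic energy `⟨−T⟩` is non-increasing in `U` across the torus-limit ground-state classes: `IsTorusLimitOf.docc_le_and_oneBody_le_of_groundStates`
against an inhabitant of the class at `U₀`). [cite: Griffiths1966, §II] [cite: KomaTasaki1994, §1] -/
theorem forall_torusLimit_negKinetic_le_of_le_coupling {U₀ U : ℝ} (hU₀ : 0 ≤ U₀) (hU : U₀ ≤ U) {n : ℝ} (hn0 : 0 ≤ n) (hn2 : n < 2)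
    {X : ℝ}
    (hX : ∀ (ω : InfVolFermionState 2) (Ls : ℕ → ℕ) (ψ : ∀ L, Fock (Orb (FermionTorus 2 L))),
      Tendsto Ls atTop atTop →
      (∀ j, IsGroundStateInSector (hubbardTorusTT' (Ls j) 1 0 U₀) (rectN n (Ls j)) 0 (ψ (Ls j))) →
      (∀ j, star (ψ (Ls j)) ⬝ᵥ ψ (Ls j) = 1) → ω.IsTorusLimitOf ψ Ls →
      -(∑ i : Fin 2, -(1 : ℝ) * ∑ σ : Fin 2,
          ((ω.expect {0, 0 + unitVec i}
              ((cAt 0 (mem_insert_self _ _) σ)ᴴ * cAt (0 + unitVec i) (mem_insert_of_mem (mem_singleton_self _)) σ)).re +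
            (ω.expect {0, 0 + unitVec i}
              ((cAt (0 + unitVec i) (mem_insert_of_mem (mem_singleton_self _)) σ)ᴴ * cAt 0 (mem_insert_self _ _) σ)).re)) ≤ X) :
    ∀ (ω : InfVolFermionState 2) (Ls : ℕ → ℕ) (ψ : ∀ L, Fock (Orb (FermionTorus 2 L))),
      Tendsto Ls atTop atTop →
      (∀ j, IsGroundStateInSector (hubbardTorusTT' (Ls j) 1 0 U) (rectN n (Ls j)) 0 (ψ (Ls j))) →
      (∀ j, star (ψ (Ls j)) ⬝ᵥ ψ (Ls j) = 1) → ω.IsTorusLimitOf ψ Ls →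
      -(∑ i : Fin 2, -(1 : ℝ) * ∑ σ : Fin 2,
          ((ω.expect {0, 0 + unitVec i}
              ((cAt 0 (mem_insert_self _ _) σ)ᴴ * cAt (0 + unitVec i) (mem_insert_of_mem (mem_singleton_self _)) σ)).re +
            (ω.expect {0, 0 + unitVec i}
              ((cAt (0 + unitVec i) (mem_insert_of_mem (mem_singleton_self _)) σ)ᴴ * cAt 0 (mem_insert_self _ _) σ)).re)) ≤ X := by
  intro ω Ls ψ hLs hψ hψ1 hω
  rcases eq_or_lt_of_le hU with rfl | hlt
  · exact hX ω Ls ψ hLs hψ hψ1 hω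
  · -- an inhabitant of the class at the anchor coupling `U₀`
    obtain ⟨ψA, φ, ωA, hφ, hψA, hψA1, hωA, -, -, -⟩ :=
      exists_isTorusLimitOf_sectorGroundState_TT' 1 0 U₀ hn0 hn2.le (Ls := id) tendsto_id
    have hLφ : Tendsto (id ∘ φ : ℕ → ℕ) atTop atTop := tendsto_id.comp hφ.tendsto_atTop
    -- T-mono: the one-body energy is non-decreasing in `U`
    have hmono := (InfVolFermionState.IsTorusLimitOf.docc_le_and_oneBody_le_of_groundStates 1 0 hU₀ hlt hn0 hn2 hωA hLφ
      (fun j => hψA _) (fun j => hψA1 _) hω hLs hψ hψ1).2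
    rw [meanEnergy_hubbardTTPrime_oneBody_eq_kineticDensity hωA.isTranslationInvariant,
      meanEnergy_hubbardTTPrime_oneBody_eq_kineticDensity hω.isTranslationInvariant] at hmono
    have hA := hX ωA (id ∘ φ) ψA hLφ (fun j => hψA _) (fun j => hψA1 _) hωA
    linarith

/-- **A certified kinetic FLOOR transports DOWN the `U`-ray.** `0 ≤ U ≤ U₀`, `0 ≤ n < 2`: if `K ≤ −k(ω)` for every torus limit of unit
`(rectN n L, S^z = 0)`-sector ground states at `U₀`, then `K ≤ −k(ω′)` for every such torus limit at `U`.
[cite: Griffiths1966, §II] [cite: KomaTasaki1994, §1] -/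
theorem forall_torusLimit_le_negKinetic_of_coupling_le {U₀ U : ℝ} (hU0 : 0 ≤ U) (hU : U ≤ U₀) {n : ℝ} (hn0 : 0 ≤ n) (hn2 : n < 2)
    {K : ℝ}
    (hK : ∀ (ω : InfVolFermionState 2) (Ls : ℕ → ℕ) (ψ : ∀ L, Fock (Orb (FermionTorus 2 L))),
      Tendsto Ls atTop atTop →
      (∀ j, IsGroundStateInSector (hubbardTorusTT' (Ls j) 1 0 U₀) (rectN n (Ls j)) 0 (ψ (Ls j))) →
      (∀ j, star (ψ (Ls j)) ⬝ᵥ ψ (Ls j) = 1) → ω.IsTorusLimitOf ψ Ls →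
      K ≤ -(∑ i : Fin 2, -(1 : ℝ) * ∑ σ : Fin 2,
          ((ω.expect {0, 0 + unitVec i}
              ((cAt 0 (mem_insert_self _ _) σ)ᴴ * cAt (0 + unitVec i) (mem_insert_of_mem (mem_singleton_self _)) σ)).re +
            (ω.expect {0, 0 + unitVec i}
              ((cAt (0 + unitVec i) (mem_insert_of_mem (mem_singleton_self _)) σ)ᴴ * cAt 0 (mem_insert_self _ _) σ)).re))) :
    ∀ (ω : InfVolFermionState 2) (Ls : ℕ → ℕ) (ψ : ∀ L, Fock (Orb (FermionTorus 2 L))),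
      Tendsto Ls atTop atTop →
      (∀ j, IsGroundStateInSector (hubbardTorusTT' (Ls j) 1 0 U) (rectN n (Ls j)) 0 (ψ (Ls j))) →
      (∀ j, star (ψ (Ls j)) ⬝ᵥ ψ (Ls j) = 1) → ω.IsTorusLimitOf ψ Ls →
      K ≤ -(∑ i : Fin 2, -(1 : ℝ) * ∑ σ : Fin 2,
          ((ω.expect {0, 0 + unitVec i}
              ((cAt 0 (mem_insert_self _ _) σ)ᴴ * cAt (0 + unitVec i) (mem_insert_of_mem (mem_singleton_self _)) σ)).re +
            (ω.expect {0, 0 + unitVec i}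
              ((cAt (0 + unitVec i) (mem_insert_of_mem (mem_singleton_self _)) σ)ᴴ * cAt 0 (mem_insert_self _ _) σ)).re)) := by
  intro ω Ls ψ hLs hψ hψ1 hω
  rcases eq_or_lt_of_le hU with rfl | hlt
  · exact hK ω Ls ψ hLs hψ hψ1 hω
  · -- an inhabitant of the class at the anchor coupling `U₀`
    obtain ⟨ψP, φ, ωP, hφ, hψP, hψP1, hωP, -, -, -⟩ :=
      exists_isTorusLimitOf_sectorGroundState_TT' 1 0 U₀ hn0 hn2.le (Ls := id) tendsto_id
    have hLφ : Tendsto (id ∘ φ : ℕ → ℕ) atTop atTop := tendsto_id.comp hφ.tendsto_atTop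
    have hmono := (InfVolFermionState.IsTorusLimitOf.docc_le_and_oneBody_le_of_groundStates 1 0 hU0 hlt hn0 hn2 hω hLs hψ hψ1
      hωP hLφ (fun j => hψP _) (fun j => hψP1 _)).2
    rw [meanEnergy_hubbardTTPrime_oneBody_eq_kineticDensity hωP.isTranslationInvariant,
      meanEnergy_hubbardTTPrime_oneBody_eq_kineticDensity hω.isTranslationInvariant] at hmono
    have hP := hK ωP (id ∘ φ) ψP hLφ (fun j => hψP _) (fun j => hψP1 _) hωP
    linarith

/-! ## §3 The f-sum stiffness ceiling on the half-line `U ≥ U₀` -/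

/-- **f-sum stiffness ceiling on the whole `U`-ray from ONE certified kinetic ceiling.** `0 ≤ U₀ ≤ U`, `−1 < δ ≤ 1`: if `−k(ω) ≤ X` for every
torus limit `ω` of unit `(rectN (1 − δ) L, S^z = 0)`-sector ground states of `hubbardTorusTT' L 1 0 U₀`, then at coupling `U` every flux
stiffness `ρ_s > 0` (scale `θ₀ > 0`, all even `L ≥ L₀`) of the zero-flux `(N_L, 0)` sectors of `hubbardTorus 2 L 1 U` satisfies `ρ_s ≤ X/4`
(tree units; HVR `½(D_s^x + D_s^y) ≤ X/8`). = `fluxStiffness_le_quarter_of_forall_torusLimit_negKinetic_le` at `U` fed by §2.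
[cite: ScalapinoWhiteZhang1993, §II] -/
theorem fluxStiffness_le_quarter_on_ray {U₀ U δ X : ℝ} (hU₀ : 0 ≤ U₀) (hU : U₀ ≤ U) (hδ1 : -1 < δ) (hδ2 : δ ≤ 1)
    (hX : ∀ (ω : InfVolFermionState 2) (Ls : ℕ → ℕ) (ψ : ∀ L, Fock (Orb (FermionTorus 2 L))),
      Tendsto Ls atTop atTop →
      (∀ j, IsGroundStateInSector (hubbardTorusTT' (Ls j) 1 0 U₀) (rectN (1 - δ) (Ls j)) 0 (ψ (Ls j))) →
      (∀ j, star (ψ (Ls j)) ⬝ᵥ ψ (Ls j) = 1) → ω.IsTorusLimitOf ψ Ls →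
      -(∑ i : Fin 2, -(1 : ℝ) * ∑ σ : Fin 2,
          ((ω.expect {0, 0 + unitVec i}
              ((cAt 0 (mem_insert_self _ _) σ)ᴴ * cAt (0 + unitVec i) (mem_insert_of_mem (mem_singleton_self _)) σ)).re +
            (ω.expect {0, 0 + unitVec i}
              ((cAt (0 + unitVec i) (mem_insert_of_mem (mem_singleton_self _)) σ)ᴴ * cAt 0 (mem_insert_self _ _) σ)).re)) ≤ X) :
    ∀ (ρs θ₀ : ℝ), 0 < ρs → 0 < θ₀ → ∀ L₀ : ℕ,
      (∀ (L : ℕ) [NeZero L], L₀ ≤ L → Even L →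
        ∀ θ : ℝ, |θ| ≤ θ₀ → ρs * θ ^ 2 ≤ fluxEnergy L U δ θ - fluxEnergy L U δ 0) →
      ρs ≤ X / 4 :=
  fluxStiffness_le_quarter_of_forall_torusLimit_negKinetic_le (hU₀.trans hU) hδ1 hδ2
    (forall_torusLimit_negKinetic_le_of_le_coupling hU₀ hU (by linarith) (by linarith) hX)

/-- **The class floor on the segment `[0, U₀]`.** `0 ≤ U ≤ U₀`, `0 ≤ n < 2`: if `K ≤ −k(ω)` for every torus-limit ground state of the class at
`U₀`, then every real `X` that bounds `−k` from above on the class at `U` (what any certified kinetic ceiling at `U` delivers) satisfies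
`K ≤ X` — the class at `U` is inhabited (`exists_isTorusLimitOf_sectorGroundState_TT'`) and §2 transports the floor to it.
[cite: KomaTasaki1994, §1] -/
theorem negKinetic_classFloor_on_ray {U₀ U : ℝ} (hU0 : 0 ≤ U) (hU : U ≤ U₀) {n : ℝ} (hn0 : 0 ≤ n) (hn2 : n < 2) {K X : ℝ}
    (hK : ∀ (ω : InfVolFermionState 2) (Ls : ℕ → ℕ) (ψ : ∀ L, Fock (Orb (FermionTorus 2 L))),
      Tendsto Ls atTop atTop →
      (∀ j, IsGroundStateInSector (hubbardTorusTT' (Ls j) 1 0 U₀) (rectN n (Ls j)) 0 (ψ (Ls j))) →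
      (∀ j, star (ψ (Ls j)) ⬝ᵥ ψ (Ls j) = 1) → ω.IsTorusLimitOf ψ Ls →
      K ≤ -(∑ i : Fin 2, -(1 : ℝ) * ∑ σ : Fin 2,
          ((ω.expect {0, 0 + unitVec i}
              ((cAt 0 (mem_insert_self _ _) σ)ᴴ * cAt (0 + unitVec i) (mem_insert_of_mem (mem_singleton_self _)) σ)).re +
            (ω.expect {0, 0 + unitVec i}
              ((cAt (0 + unitVec i) (mem_insert_of_mem (mem_singleton_self _)) σ)ᴴ * cAt 0 (mem_insert_self _ _) σ)).re)))
    (hX : ∀ (ω : InfVolFermionState 2) (Ls : ℕ → ℕ) (ψ : ∀ L, Fock (Orb (FermionTorus 2 L))),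
      Tendsto Ls atTop atTop →
      (∀ j, IsGroundStateInSector (hubbardTorusTT' (Ls j) 1 0 U) (rectN n (Ls j)) 0 (ψ (Ls j))) →
      (∀ j, star (ψ (Ls j)) ⬝ᵥ ψ (Ls j) = 1) → ω.IsTorusLimitOf ψ Ls →
      -(∑ i : Fin 2, -(1 : ℝ) * ∑ σ : Fin 2,
          ((ω.expect {0, 0 + unitVec i}
              ((cAt 0 (mem_insert_self _ _) σ)ᴴ * cAt (0 + unitVec i) (mem_insert_of_mem (mem_singleton_self _)) σ)).re +
            (ω.expect {0, 0 + unitVec i}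
              ((cAt (0 + unitVec i) (mem_insert_of_mem (mem_singleton_self _)) σ)ᴴ * cAt 0 (mem_insert_self _ _) σ)).re)) ≤ X) :
    K ≤ X := by
  obtain ⟨ψ, φ, ω, hφ, hψ, hψ1, hω, -, -, -⟩ :=
    exists_isTorusLimitOf_sectorGroundState_TT' 1 0 U hn0 hn2.le (Ls := id) tendsto_id
  have hLφ : Tendsto (id ∘ φ : ℕ → ℕ) atTop atTop := tendsto_id.comp hφ.tendsto_atTop
  have h1 := forall_torusLimit_le_negKinetic_of_coupling_le hU0 hU hn0 hn2 hK ω (id ∘ φ) ψ hLφ (fun j => hψ _)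
    (fun j => hψ1 _) hω
  have h2 := hX ω (id ∘ φ) ψ hLφ (fun j => hψ _) (fun j => hψ1 _) hω
  linarith

/-! ## §4 M3′ wrappers at `(U₀, n, t′) = (8, 7/8, 0)` -/

/-- **M3′: a certified kinetic ceiling at A0′ = (8, 7/8, 0) is an f-sum stiffness ceiling on the whole half-line `U ≥ 8`.** If
`−k(ω) ≤ X` for every torus limit of unit `(rectN (7/8) L, S^z = 0)`-sector ground states of `hubbardTorusTT' L 1 0 8` (the conclusion shape of
the cell's kinetic rows at A0′: chord #354 ∧ #426, `kinlo` EXT5-L⁺), then for every `U ≥ 8` every flux stiffness of the `(N_L, 0)` sectors of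
`hubbardTorus 2 L 1 U` at `δ = 1/8` satisfies `ρ_s ≤ X/4`. HONEST: ceiling only; informative vs kinematics at best.
[cite: HazraVermaRanderia2019, eqs. (2)–(4)] -/
theorem m3_tp0_fluxStiffness_le_quarter_on_ray_of_forall_negKinetic_le {X : ℝ}
    (hX : ∀ (ω : InfVolFermionState 2) (Ls : ℕ → ℕ) (ψ : ∀ L, Fock (Orb (FermionTorus 2 L))),
      Tendsto Ls atTop atTop →
      (∀ j, IsGroundStateInSector (hubbardTorusTT' (Ls j) 1 0 8) (rectN (7/8) (Ls j)) 0 (ψ (Ls j))) →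
      (∀ j, star (ψ (Ls j)) ⬝ᵥ ψ (Ls j) = 1) → ω.IsTorusLimitOf ψ Ls →
      -(∑ i : Fin 2, -(1 : ℝ) * ∑ σ : Fin 2,
          ((ω.expect {0, 0 + unitVec i}
              ((cAt 0 (mem_insert_self _ _) σ)ᴴ * cAt (0 + unitVec i) (mem_insert_of_mem (mem_singleton_self _)) σ)).re +
            (ω.expect {0, 0 + unitVec i}
              ((cAt (0 + unitVec i) (mem_insert_of_mem (mem_singleton_self _)) σ)ᴴ * cAt 0 (mem_insert_self _ _) σ)).re)) ≤ X)
    {U : ℝ} (hU : 8 ≤ U) :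
    ∀ (ρs θ₀ : ℝ), 0 < ρs → 0 < θ₀ → ∀ L₀ : ℕ,
      (∀ (L : ℕ) [NeZero L], L₀ ≤ L → Even L →
        ∀ θ : ℝ, |θ| ≤ θ₀ → ρs * θ ^ 2 ≤ fluxEnergy L U (1 / 8) θ - fluxEnergy L U (1 / 8) 0) →
      ρs ≤ X / 4 := by
  have h78 : (1 - 1 / 8 : ℝ) = 7 / 8 := by norm_num
  refine fluxStiffness_le_quarter_on_ray (U₀ := 8) (δ := 1 / 8) (by norm_num) hU (by norm_num) (by norm_num)
    fun ω Ls ψ hLs hψ hψ1 hω => hX ω Ls ψ hLs (fun j => ?_) hψ1 hω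
  have h := hψ j
  rwa [h78] at h

/-- **M3′: a certified kinetic-class floor at A0′ bounds every kinetic ceiling certified anywhere on `U ∈ [0, 8]`** (density `7/8`, `t′ = 0`):
if `K ≤ −k(ω)` on the class at `U₀ = 8`, then every `X` with `−k ≤ X` on the class at some `U ∈ [0, 8]` has `K ≤ X` — so every f-sum stiffness
ceiling `X/4` certified on that segment reads `≥ K/4`. [cite: KomaTasaki1994, §1] -/
theorem m3_tp0_negKinetic_classFloor_below_of_forall_le_negKinetic {K : ℝ}
    (hK : ∀ (ω : InfVolFermionState 2) (Ls : ℕ → ℕ) (ψ : ∀ L, Fock (Orb (FermionTorus 2 L))),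
      Tendsto Ls atTop atTop →
      (∀ j, IsGroundStateInSector (hubbardTorusTT' (Ls j) 1 0 8) (rectN (7/8) (Ls j)) 0 (ψ (Ls j))) →
      (∀ j, star (ψ (Ls j)) ⬝ᵥ ψ (Ls j) = 1) → ω.IsTorusLimitOf ψ Ls →
      K ≤ -(∑ i : Fin 2, -(1 : ℝ) * ∑ σ : Fin 2,
          ((ω.expect {0, 0 + unitVec i}
              ((cAt 0 (mem_insert_self _ _) σ)ᴴ * cAt (0 + unitVec i) (mem_insert_of_mem (mem_singleton_self _)) σ)).re +
            (ω.expect {0, 0 + unitVec i}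
              ((cAt (0 + unitVec i) (mem_insert_of_mem (mem_singleton_self _)) σ)ᴴ * cAt 0 (mem_insert_self _ _) σ)).re)))
    {U : ℝ} (hU0 : 0 ≤ U) (hU : U ≤ 8) {X : ℝ}
    (hX : ∀ (ω : InfVolFermionState 2) (Ls : ℕ → ℕ) (ψ : ∀ L, Fock (Orb (FermionTorus 2 L))),
      Tendsto Ls atTop atTop →
      (∀ j, IsGroundStateInSector (hubbardTorusTT' (Ls j) 1 0 U) (rectN (7/8) (Ls j)) 0 (ψ (Ls j))) →
      (∀ j, star (ψ (Ls j)) ⬝ᵥ ψ (Ls j) = 1) → ω.IsTorusLimitOf ψ Ls →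
      -(∑ i : Fin 2, -(1 : ℝ) * ∑ σ : Fin 2,
          ((ω.expect {0, 0 + unitVec i}
              ((cAt 0 (mem_insert_self _ _) σ)ᴴ * cAt (0 + unitVec i) (mem_insert_of_mem (mem_singleton_self _)) σ)).re +
            (ω.expect {0, 0 + unitVec i}
              ((cAt (0 + unitVec i) (mem_insert_of_mem (mem_singleton_self _)) σ)ᴴ * cAt 0 (mem_insert_self _ _) σ)).re)) ≤ X) :
    K ≤ X :=
  negKinetic_classFloor_on_ray (U₀ := 8) hU0 hU (n := 7/8) (by norm_num) (by norm_num) hK hX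

end Summit.Ventures.CertifiedManyBodySolver.Observables

end
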